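import Literature.NumberTheory.EllipticCurves.ComplexTorus
import Literature.NumberTheory.EllipticCurves.WeierstrassAdditionProofs
import HarnessLib

/-!
# `z ↦ (℘(z), ℘'(z)/2)` is a group homomorphism (the addition theorem for `℘'`) — proofs

Companion `…Proofs` file (D-0014) of `Literature/NumberTheory/EllipticCurves/ComplexTorus.lean`.
It **discharges the named fact `PeriodPair.toPoint_add`** of that file (Silverman, *The
Arithmetic of Elliptic Curves*, Prop. VI.3.6(b): `φ : ℂ/Λ → E_Λ(ℂ)`, `z ↦ [℘(z), ℘'(z), 1]` is a
group homomorphism):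

* `PeriodPair.toPoint_add_holds : L.toPoint_add`, i.e.
  `toPoint (z + w) = toPoint z + toPoint w` for all `z, w : ℂ`, where
  `toPoint z = (℘(z), ℘'(z)/2) ∈ E_Λ(ℂ)`, `E_Λ : y² = x³ − (g₂/4)x − g₃/4`, and `+` is Mathlib's
  chord-tangent group law (`WeierstrassCurve.Affine.Point`);

so that, with `toPoint_surjective` and `toPoint_eq_toPoint_iff` of `ComplexTorus.lean`,
VI.3.6(b) is proved as an isomorphism of groups `ℂ/Λ ≃ E_Λ(ℂ)`, and
`PeriodPair.exists_addMonoidHom_of_g₂_g₃` becomes unconditional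
(`exists_addMonoidHom_of_g₂_g₃'`): for every Weierstrass model `W/ℂ` with `g₂(Λ) = c₄(W)/12`,
`g₃(Λ) = c₆(W)/216` there is a surjective homomorphism `ℂ →+ W(ℂ)` with kernel `Λ` — the
conclusion of the named fact `Literature.NumberTheory.EllipticCurves.ModularForms.IsNeronLatticeOf.exists_uniformize`
(`ModularParametrization.lean`, leaf 3 of `Literature.NumberTheory.EllipticCurves.ModularForms.nonempty_modularParametrizationData`;
assembled in `ModularParametrizationProofs.lean`).

The analytic input is the **addition theorem for `℘` together with its companion for `℘'`**
(the `y`-coordinate of the chord-tangent law, Silverman AEC III.2.3(c):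
`y₃ = −(λ + a₁)x₃ − ν − a₃`), and the duplication formulas. The `x`-coordinate statements are the
tree's discharged named facts `PeriodPair.weierstrassP_add_holds` (Armitage–Eberlein, *Elliptic
Functions*, Thm. 7.2, eq. (7.68): for `u, v ∉ Λ` with `℘(u) ≠ ℘(v)` and
`q = (℘'(u) − ℘'(v))/(℘(u) − ℘(v))`, `℘(u + v) = q²/4 − ℘(u) − ℘(v)`) and
`PeriodPair.weierstrassP_two_mul_holds` (loc. cit., Cor. 7.1: `℘(2u) = ¼ (℘''(u)/℘'(u))² − 2℘(u)`)
of `WeierstrassAdditionProofs.lean` (the `σ`-function route of the book), used as such; the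
`y`-coordinate statements are proved here (§§1–3):

* `PeriodPair.derivWeierstrassP_add_of_ne` — `℘'(u + v) = −(℘'(u) + q · (℘(u + v) − ℘(u)))`;
* `PeriodPair.derivWeierstrassP_two_mul_of_notMem` — for `u, 2u ∉ Λ`,
  `℘'(2u) = −(℘'(u) + (℘''(u)/℘'(u)) · (℘(2u) − ℘(u)))`.

No definitions are introduced (the chord functions `q`, `X`, `Y` are local notation).

## Proof of the `℘'`-formulas (§§1–3)

Fix `u ∉ Λ` and put, for `t ∉ Λ` with `℘(t) ≠ ℘(u)`, `q(t) = (℘'(t) − ℘'(u))/(℘(t) − ℘(u))`,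
`X(t) = q²/4 − ℘(t) − ℘(u)` and `Y(t) = −(℘'(u) + q (X − ℘(u)))`.

1. *Algebra* (`hasDerivAt_addX`): `X' = Y`, an identity in `ℚ(g₂, g₃)(℘(t), ℘'(t), ℘(u), ℘'(u))`
   modulo `℘'² = 4℘³ − g₂℘ − g₃` at `t` (Mathlib `derivWeierstrassP_sq`) and `℘'' = 6℘² − g₂/2`
   (the tree's `hasDerivAt_derivWeierstrassP`).
2. *Differentiation* (`derivWeierstrassP_add_eq_addY`, `derivWeierstrassP_add_of_ne`): by the
   tree's addition theorem (`weierstrassP_add_holds`, symmetrised by `weierstrassP_add_symm`),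
   `℘(u + t) = X(t)` for all `t` in the open set `V_u = {t | t, u + t ∉ Λ, ℘(t) ≠ ℘(u)}`
   (`eventually_mem_addDomain`), so the derivatives agree there: `℘'(u + t) = X'(t) = Y(t)`.
3. *Duplication* (`derivWeierstrassP_two_mul_of_notMem`): let `t → u` inside `V_u` (a punctured
   neighbourhood of `u` lies in `V_u` when `2u ∉ Λ`, by the tree's
   `weierstrassP_eq_weierstrassP_iff`: `℘(t) = ℘(u)` forces `t ≡ ±u`): `q(t) → ℘''(u)/℘'(u)` as a
   quotient of difference quotients (`tendsto_addSlope`; `℘'(u) ≠ 0` since `2u ∉ Λ`,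
   `two_mul_mem_lattice_of_derivWeierstrassP_eq_zero`), and `℘(2u)` is the tree's
   `weierstrassP_two_mul_holds`.

## Proof of `toPoint_add` (§4)

By cases against Mathlib's definition of `+` on `E_Λ(ℂ)`:
* `z ∈ Λ` or `w ∈ Λ`: periodicity (`toPoint_add_coe`); `z + w ∈ Λ`: `toPoint w = −toPoint z`
  (`toPoint_neg`);
* `z − w ∈ Λ`, `z + w ∉ Λ` (tangent case, `2z ∉ Λ`, `℘'(z) ≠ 0`): Mathlib's tangent slope is
  `(3x² + a₄)/(2y) = ℘''(z)/(2℘'(z))`, and the duplication formulas (`weierstrassP_two_mul_holds`,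
  §3) are exactly Mathlib's `addX`, `addY`;
* otherwise `℘(z) ≠ ℘(w)` (`weierstrassP_eq_weierstrassP_iff`), Mathlib's chord slope is `q/2`,
  and the addition theorems (`weierstrassP_add_holds`, §2) are Mathlib's `addX`, `addY`.

## References

* J. H. Silverman, *The Arithmetic of Elliptic Curves*, 2nd ed., GTM 106, Springer 2009:
  III.2.3 (Group Law Algorithm), Prop. VI.3.6(b) (PDF pp. 151–152).
* J. V. Armitage, W. F. Eberlein, *Elliptic Functions*, LMS Student Texts 67, CUP 2006 (2001):
  §7.4.2, Thm. 7.2 (eq. (7.68)) and Cor. 7.1 (PDF p. 119, print p. 184).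
-/

noncomputable section

open Complex Filter Topology Bornology Set

namespace PeriodPair

variable (L : PeriodPair)

/-! ### Local notation

No definitions are introduced; for a period pair `L` and `u : ℂ` we write (local notation,
functions of `t : ℂ`)
* `q⟦L, u⟧ = fun t ↦ (℘'(t) − ℘'(u))/(℘(t) − ℘(u))` — the chord slope,
* `X⟦L, u⟧ = fun t ↦ q²/4 − ℘(t) − ℘(u)` — the right-hand side of the addition theorem (7.68),
* `Y⟦L, u⟧ = fun t ↦ −(℘'(u) + q · (X − ℘(u)))` — minus the ordinate of the chord above `X`
  (Silverman AEC III.2.3(c) with `a₁ = a₃ = 0`). -/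

local notation "q⟦" L ", " u "⟧" =>
  fun t : ℂ ↦ (℘'[L] t - ℘'[L] u) / (℘[L] t - ℘[L] u)

local notation "X⟦" L ", " u "⟧" =>
  fun t : ℂ ↦ ((℘'[L] t - ℘'[L] u) / (℘[L] t - ℘[L] u)) ^ 2 / 4 - ℘[L] t - ℘[L] u

local notation "Y⟦" L ", " u "⟧" =>
  fun t : ℂ ↦ -(℘'[L] u + (℘'[L] t - ℘'[L] u) / (℘[L] t - ℘[L] u) *
    ((((℘'[L] t - ℘'[L] u) / (℘[L] t - ℘[L] u)) ^ 2 / 4 - ℘[L] t - ℘[L] u) - ℘[L] u))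

/-! ### The differential-algebraic identity `X' = Y` -/

section Algebra

/-- With `q = (y − y₁)/(x − x₁)`, `q' = ((6x² − g₂/2)(x − x₁) − (y − y₁)y)/(x − x₁)²` (the
`t`-derivative of `q` along `(x, y) = (℘, ℘')(t)`), `X = q²/4 − x − x₁`:
`X' = 2qq'/4 − y = −(y₁ + q(X − x₁))`, modulo the two Weierstrass equations. [folklore] -/
private lemma addFormula_alg₁ {x y x₁ y₁ g₂ g₃ : ℂ} (hD : x - x₁ ≠ 0)
    (h : y ^ 2 = 4 * x ^ 3 - g₂ * x - g₃) (h₁ : y₁ ^ 2 = 4 * x₁ ^ 3 - g₂ * x₁ - g₃) :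
    2 * ((y - y₁) / (x - x₁))
          * (((6 * x ^ 2 - g₂ / 2) * (x - x₁) - (y - y₁) * y) / (x - x₁) ^ 2) / 4 - y =
      -(y₁ + (y - y₁) / (x - x₁) * (((y - y₁) / (x - x₁)) ^ 2 / 4 - x - x₁ - x₁)) := by
  field_simp
  linear_combination (-(y - y₁)) * h + (y - y₁) * h₁

end Algebra

/-! ### The chord functions `q`, `X`, `Y` and `X' = Y` -/

section Formula

variable {L}

/-- `q' = ((6℘² − g₂/2)(℘ − ℘(u)) − (℘' − ℘'(u))℘')/(℘ − ℘(u))²` off the lattice where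
`℘ ≠ ℘(u)` (quotient rule with `℘'' = 6℘² − g₂/2`). [folklore] -/
theorem hasDerivAt_addSlope {u t : ℂ} (ht : t ∉ L.lattice) (hx : ℘[L] t ≠ ℘[L] u) :
    HasDerivAt q⟦L, u⟧
      (((6 * ℘[L] t ^ 2 - L.g₂ / 2) * (℘[L] t - ℘[L] u) - (℘'[L] t - ℘'[L] u) * ℘'[L] t) /
        (℘[L] t - ℘[L] u) ^ 2) t :=
  ((L.hasDerivAt_derivWeierstrassP ht).sub_const _).div
    ((hasDerivAt_weierstrassP ht).sub_const _) (sub_ne_zero.mpr hx)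

/-- **`X' = Y`** off the lattice where `℘ ≠ ℘(u)` (`u ∉ Λ`): the first differential-algebraic
identity (`X = q²/4 − ℘ − ℘(u)`, `Y = −(℘'(u) + q(X − ℘(u)))`, `q` the chord slope). [folklore] -/
theorem hasDerivAt_addX {u t : ℂ} (hu : u ∉ L.lattice) (ht : t ∉ L.lattice)
    (hx : ℘[L] t ≠ ℘[L] u) : HasDerivAt X⟦L, u⟧ (Y⟦L, u⟧ t) t := by
  have h := (((hasDerivAt_addSlope ht hx).pow 2).div_const 4).sub
    (hasDerivAt_weierstrassP ht) |>.sub_const (℘[L] u)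
  refine h.congr_deriv ?_
  simp only [Nat.cast_ofNat, Nat.add_one_sub_one, pow_one]
  exact addFormula_alg₁ (sub_ne_zero.mpr hx) (L.derivWeierstrassP_sq t ht)
    (L.derivWeierstrassP_sq u hu)

end Formula

/-! ### The addition theorem for `℘'` by differentiation on `V_u` -/

section Global

variable {L}

/-- The set `{t ∉ Λ | ℘(t) ≠ ℘(u)}` is open. [folklore] -/
theorem isOpen_setOf_weierstrassP_ne (u : ℂ) :
    IsOpen {t : ℂ | t ∉ L.lattice ∧ ℘[L] t ≠ ℘[L] u} := by
  rw [isOpen_iff_eventually]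
  rintro t ⟨ht, hx⟩
  have hn : (L.lattice : Set ℂ)ᶜ ∈ 𝓝 t := L.isClosed_lattice.isOpen_compl.mem_nhds ht
  have hc : ContinuousAt ℘[L] t :=
    (L.differentiableOn_weierstrassP.differentiableAt hn).continuousAt
  filter_upwards [hn, hc.eventually_ne hx] with s hs hs'
  exact ⟨hs, hs'⟩

/-- `V_u` is a neighbourhood of each of its points. [folklore] -/
theorem eventually_mem_addDomain {u t : ℂ} (ht : t ∉ L.lattice) (hut : u + t ∉ L.lattice)
    (hx : ℘[L] t ≠ ℘[L] u) :
    ∀ᶠ s in 𝓝 t, s ∉ L.lattice ∧ u + s ∉ L.lattice ∧ ℘[L] s ≠ ℘[L] u := by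
  have hopen : IsOpen ((L.lattice : Set ℂ)ᶜ) := L.isClosed_lattice.isOpen_compl
  have h1 : ∀ᶠ s in 𝓝 t, u + s ∉ L.lattice := by
    have hc : Continuous fun s : ℂ ↦ u + s := by fun_prop
    exact hc.continuousAt.preimage_mem_nhds (hopen.mem_nhds (by simpa using hut))
  filter_upwards [(isOpen_setOf_weierstrassP_ne u).mem_nhds ⟨ht, hx⟩, h1] with s hs hs'
  exact ⟨hs.1, hs', hs.2⟩

/-- Functional form of the tree's addition theorem on `V_u`: `℘(u + t) = X(t)` for `u, t ∉ Λ`,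
`℘(t) ≠ ℘(u)` (`weierstrassP_add_holds` with `weierstrassP_add_symm`). [folklore] -/
private theorem weierstrassP_add_eq_addX {u t : ℂ} (hu : u ∉ L.lattice) (ht : t ∉ L.lattice)
    (hx : ℘[L] t ≠ ℘[L] u) : ℘[L] (u + t) = X⟦L, u⟧ t :=
  (L.weierstrassP_add_holds u t hu ht hx.symm).trans (weierstrassP_add_symm u t)

/-- **Addition theorem for `℘'`, chord form on `V_u`**: `℘'(u + v) = Y(v)` for
`u, v, u + v ∉ Λ`, `℘(v) ≠ ℘(u)` (differentiate `℘(u + ·) = X` near `v` and use `X' = Y`).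
[cite: SilvermanAEC2009, III.2.3(c)] -/
theorem derivWeierstrassP_add_eq_addY {u v : ℂ} (hu : u ∉ L.lattice) (hv : v ∉ L.lattice)
    (huv : u + v ∉ L.lattice) (hx : ℘[L] v ≠ ℘[L] u) : ℘'[L] (u + v) = Y⟦L, u⟧ v := by
  have hEq : (fun t ↦ ℘[L] (u + t)) =ᶠ[𝓝 v] X⟦L, u⟧ :=
    (eventually_mem_addDomain hv huv hx).mono
      fun t ht ↦ weierstrassP_add_eq_addX hu ht.1 ht.2.2
  have h1 : HasDerivAt (fun t ↦ ℘[L] (u + t)) (℘'[L] (u + v)) v :=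
    HasDerivAt.comp_const_add u v (hasDerivAt_weierstrassP huv)
  have h2 : HasDerivAt (fun t ↦ ℘[L] (u + t)) (Y⟦L, u⟧ v) v :=
    (hasDerivAt_addX hu hv hx).congr_of_eventuallyEq hEq
  exact h1.unique h2

/-- **Addition theorem for `℘'`** (the `y`-coordinate of the chord law, Silverman AEC III.2.3(c)
`y₃ = −(λ + a₁)x₃ − ν − a₃` read on `Y² = 4X³ − g₂X − g₃` through VI.3.6(b)): for `u, v ∉ Λ` with
`℘(u) ≠ ℘(v)` and `q = (℘'(u) − ℘'(v))/(℘(u) − ℘(v))`,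
`℘'(u + v) = −(℘'(u) + q · (℘(u + v) − ℘(u)))`. [cite: SilvermanAEC2009, III.2.3(c)] -/
theorem derivWeierstrassP_add_of_ne {u v : ℂ} (hu : u ∉ L.lattice) (hv : v ∉ L.lattice)
    (hne : ℘[L] u ≠ ℘[L] v) :
    ℘'[L] (u + v) =
      -(℘'[L] u + (℘'[L] u - ℘'[L] v) / (℘[L] u - ℘[L] v) * (℘[L] (u + v) - ℘[L] u)) := by
  have huv := add_notMem_lattice_of_weierstrassP_ne hne
  rw [derivWeierstrassP_add_eq_addY hu hv huv hne.symm, weierstrassP_add_eq_addX hu hv hne.symm]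
  beta_reduce
  rw [← neg_sub (℘'[L] u) (℘'[L] v), ← neg_sub (℘[L] u) (℘[L] v), neg_div_neg_eq]

end Global

/-! ### The duplication formulas (`v → u`) -/

section Duplication

variable {L}

/-- Near `u` (punctured), `t ∈ V_u` provided `u, 2u ∉ Λ`. [folklore] -/
theorem eventually_nhdsNE_mem_addDomain {u : ℂ} (hu : u ∉ L.lattice) (h2u : 2 * u ∉ L.lattice) :
    ∀ᶠ t in 𝓝[≠] u, t ∉ L.lattice ∧ u + t ∉ L.lattice ∧ ℘[L] t ≠ ℘[L] u := by
  have hopen : IsOpen ((L.lattice : Set ℂ)ᶜ) := L.isClosed_lattice.isOpen_compl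
  have h1 : ∀ᶠ t in 𝓝 u, t ∉ L.lattice := hopen.mem_nhds hu
  have h2 : ∀ᶠ t in 𝓝 u, u + t ∉ L.lattice := by
    have hc : Continuous fun s : ℂ ↦ u + s := by fun_prop
    exact hc.continuousAt.preimage_mem_nhds
      (hopen.mem_nhds (by rw [← two_mul]; simpa using h2u))
  have h3 : ∀ᶠ t in 𝓝[≠] u, t - u ∉ L.lattice := by
    have ht : Tendsto (fun t ↦ t - u) (𝓝[≠] u) (𝓝[≠] 0) := by
      refine tendsto_nhdsWithin_of_tendsto_nhds_of_eventually_within _ ?_ ?_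
      · have hc : Continuous fun t : ℂ ↦ t - u := by fun_prop
        have h := hc.tendsto u
        simp only [sub_self] at h
        exact h.mono_left nhdsWithin_le_nhds
      · filter_upwards [self_mem_nhdsWithin] with t (ht : t ≠ u)
        simpa [sub_eq_zero] using ht
    exact ht.eventually L.eventually_nhdsNE_notMem_lattice
  filter_upwards [mem_nhdsWithin_of_mem_nhds h1, mem_nhdsWithin_of_mem_nhds h2, h3]
    with t ht hut htu
  refine ⟨ht, hut, fun hx ↦ ?_⟩
  rcases ((L.weierstrassP_eq_weierstrassP_iff ht hu).mp hx).symm with h | h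
  · exact htu h
  · exact hut (by rwa [add_comm] at h)

/-- The chord slope tends to the tangent slope: `q(t) → ℘''(u)/℘'(u)` as `t → u` (`u ∉ Λ`,
`℘'(u) ≠ 0`), as a quotient of difference quotients. [folklore] -/
theorem tendsto_addSlope {u : ℂ} (hu : u ∉ L.lattice) (h0 : ℘'[L] u ≠ 0) :
    Tendsto q⟦L, u⟧ (𝓝[≠] u) (𝓝 (deriv ℘'[L] u / ℘'[L] u)) := by
  have h1 : Tendsto (slope ℘'[L] u) (𝓝[≠] u) (𝓝 (deriv ℘'[L] u)) :=
    hasDerivAt_iff_tendsto_slope.mp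
      (L.hasDerivAt_derivWeierstrassP hu).differentiableAt.hasDerivAt
  have h2 : Tendsto (slope ℘[L] u) (𝓝[≠] u) (𝓝 (℘'[L] u)) :=
    hasDerivAt_iff_tendsto_slope.mp (hasDerivAt_weierstrassP hu)
  refine (h1.div h2 h0).congr' ?_
  filter_upwards [self_mem_nhdsWithin] with t (ht : t ≠ u)
  have htu : t - u ≠ 0 := sub_ne_zero.mpr ht
  simp only [Pi.div_apply, slope_def_field]
  field_simp

/-- **Duplication formula for `℘'`** (the `y`-coordinate of the tangent law, Silverman AEC
III.2.3(c), read on `Y² = 4X³ − g₂X − g₃`): for `u, 2u ∉ Λ` (so `℘'(u) ≠ 0`),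
`℘'(2u) = −(℘'(u) + (℘''(u)/℘'(u)) (℘(2u) − ℘(u)))`; the limit `v → u` of the addition theorem
for `℘'` along `V_u`. The companion formula for `℘(2u)` (Armitage–Eberlein Cor. 7.1) is the tree's
discharged named fact `PeriodPair.weierstrassP_two_mul_holds` (`WeierstrassAdditionProofs.lean`),
used here. [cite: SilvermanAEC2009, III.2.3(c)] [cite: ArmitageEberlein2001, §7.4.2 Cor. 7.1] -/
theorem derivWeierstrassP_two_mul_of_notMem {u : ℂ} (hu : u ∉ L.lattice)
    (h2u : 2 * u ∉ L.lattice) :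
    ℘'[L] (2 * u) = -(℘'[L] u + deriv ℘'[L] u / ℘'[L] u * (℘[L] (2 * u) - ℘[L] u)) := by
  have h0 : ℘'[L] u ≠ 0 := fun h ↦ h2u (L.two_mul_mem_lattice_of_derivWeierstrassP_eq_zero hu h)
  have hx2 : ℘[L] (2 * u) = (deriv ℘'[L] u / ℘'[L] u) ^ 2 / 4 - 2 * ℘[L] u :=
    L.weierstrassP_two_mul_holds u hu h0
  set m := deriv ℘'[L] u / ℘'[L] u with hm
  have hV := eventually_nhdsNE_mem_addDomain hu h2u
  have hopen : IsOpen ((L.lattice : Set ℂ)ᶜ) := L.isClosed_lattice.isOpen_compl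
  have h2u' : u + u ∉ L.lattice := by rwa [← two_mul]
  have hq := tendsto_addSlope hu h0
  have hcP' : ContinuousAt ℘'[L] (u + u) :=
    (L.differentiableOn_derivWeierstrassP.differentiableAt (hopen.mem_nhds h2u')).continuousAt
  have hcPu : ContinuousAt ℘[L] u :=
    (L.differentiableOn_weierstrassP.differentiableAt (hopen.mem_nhds hu)).continuousAt
  have hadd : Tendsto (fun t : ℂ ↦ u + t) (𝓝[≠] u) (𝓝 (u + u)) :=
    ((continuous_const.add continuous_id).tendsto u).mono_left nhdsWithin_le_nhds
  have hF' : Tendsto (fun t ↦ ℘'[L] (u + t)) (𝓝[≠] u) (𝓝 (℘'[L] (2 * u))) := by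
    rw [two_mul]; exact hcP'.tendsto.comp hadd
  have hPt : Tendsto ℘[L] (𝓝[≠] u) (𝓝 (℘[L] u)) := hcPu.tendsto.mono_left nhdsWithin_le_nhds
  have hX : Tendsto X⟦L, u⟧ (𝓝[≠] u) (𝓝 (m ^ 2 / 4 - ℘[L] u - ℘[L] u)) :=
    ((hq.pow 2).div_const 4 |>.sub hPt).sub tendsto_const_nhds
  have hY : Tendsto Y⟦L, u⟧ (𝓝[≠] u)
      (𝓝 (-(℘'[L] u + m * (m ^ 2 / 4 - ℘[L] u - ℘[L] u - ℘[L] u)))) :=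
    ((hq.mul (hX.sub tendsto_const_nhds)).const_add _).neg
  have hEqY : (fun t ↦ ℘'[L] (u + t)) =ᶠ[𝓝[≠] u] Y⟦L, u⟧ :=
    hV.mono fun t ht ↦ derivWeierstrassP_add_eq_addY hu ht.1 ht.2.1 ht.2.2
  have := tendsto_nhds_unique_of_eventuallyEq hF' hY hEqY
  rw [this, hx2]
  ring

end Duplication

/-! ### §4 `toPoint` is additive (Silverman AEC VI.3.6(b)) -/

section ToPointAdd

/-- **Tangent case**: `toPoint (2z) = toPoint z + toPoint z` for `z, 2z ∉ Λ` (Mathlib's tangent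
law on `E_Λ` has slope `℘''(z)/(2℘'(z))`; duplication formulas for `℘`, `℘'`).
[cite: SilvermanAEC2009, Prop. VI.3.6(b)] -/
theorem toPoint_two_mul {z : ℂ} (hz : z ∉ L.lattice) (h2z : 2 * z ∉ L.lattice) :
    L.toPoint (2 * z) = L.toPoint z + L.toPoint z := by
  have h0 : ℘'[L] z ≠ 0 := fun h ↦ h2z (L.two_mul_mem_lattice_of_derivWeierstrassP_eq_zero hz h)
  have hx := L.weierstrassP_two_mul_holds z hz h0
  have hy := derivWeierstrassP_two_mul_of_notMem hz h2z
  rw [L.deriv_derivWeierstrassP hz] at hx hy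
  have hy' : ℘'[L] z / 2 ≠ L.curve.toAffine.negY (℘[L] z) (℘'[L] z / 2) := by
    simp only [WeierstrassCurve.Affine.negY, WeierstrassCurve.toAffine, curve_a₁, curve_a₃]
    intro h
    apply h0
    linear_combination h
  rw [toPoint_of_notMem hz, toPoint_of_notMem h2z,
    WeierstrassCurve.Affine.Point.add_self_of_Y_ne hy', WeierstrassCurve.Affine.Point.some.injEq]
  have hsl : L.curve.toAffine.slope (℘[L] z) (℘[L] z) (℘'[L] z / 2) (℘'[L] z / 2) =
      (6 * ℘[L] z ^ 2 - L.g₂ / 2) / ℘'[L] z / 2 := by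
    rw [WeierstrassCurve.Affine.slope_of_Y_ne rfl hy']
    have hden : ℘'[L] z / 2 - L.curve.toAffine.negY (℘[L] z) (℘'[L] z / 2) = ℘'[L] z := by
      simp only [WeierstrassCurve.Affine.negY, WeierstrassCurve.toAffine, curve_a₁, curve_a₃]
      ring
    rw [hden]
    simp only [WeierstrassCurve.toAffine, curve_a₁, curve_a₂, curve_a₄]
    ring
  simp only [WeierstrassCurve.Affine.addY, WeierstrassCurve.Affine.negAddY,
    WeierstrassCurve.Affine.addX, WeierstrassCurve.Affine.negY, hsl, WeierstrassCurve.toAffine,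
    curve_a₁, curve_a₂, curve_a₃]
  constructor
  · rw [hx]; ring
  · rw [hy, hx]; ring

/-- **Chord case**: `toPoint (z + w) = toPoint z + toPoint w` for `z, w ∉ Λ` with
`℘(z) ≠ ℘(w)` (Mathlib's chord law on `E_Λ` has slope `q/2`; addition theorems for `℘`, `℘'`).
[cite: SilvermanAEC2009, Prop. VI.3.6(b)] -/
theorem toPoint_add_of_weierstrassP_ne {z w : ℂ} (hz : z ∉ L.lattice) (hw : w ∉ L.lattice)
    (hne : ℘[L] z ≠ ℘[L] w) : L.toPoint (z + w) = L.toPoint z + L.toPoint w := by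
  have hzw : z + w ∉ L.lattice := add_notMem_lattice_of_weierstrassP_ne hne
  have hx := L.weierstrassP_add_holds z w hz hw hne
  have hy := derivWeierstrassP_add_of_ne hz hw hne
  rw [toPoint_of_notMem hz, toPoint_of_notMem hw, toPoint_of_notMem hzw,
    WeierstrassCurve.Affine.Point.add_of_X_ne hne, WeierstrassCurve.Affine.Point.some.injEq]
  simp only [WeierstrassCurve.Affine.addY, WeierstrassCurve.Affine.negAddY,
    WeierstrassCurve.Affine.addX, WeierstrassCurve.Affine.negY,
    WeierstrassCurve.Affine.slope_of_X_ne hne, WeierstrassCurve.toAffine, curve_a₁, curve_a₂,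
    curve_a₃]
  constructor
  · rw [hx]; ring
  · rw [hy, hx]; ring

/-- **Discharge of `PeriodPair.toPoint_add`** (Silverman AEC Prop. VI.3.6(b), "`φ` is a group
homomorphism"): `toPoint (z + w) = toPoint z + toPoint w` for all `z, w`, by cases — lattice
points (periodicity), `z + w ∈ Λ` (oddness), `z − w ∈ Λ` (tangent case `toPoint_two_mul`),
generic (chord case `toPoint_add_of_weierstrassP_ne`). [cite: SilvermanAEC2009, Prop. VI.3.6(b)] -/
theorem toPoint_add_holds : L.toPoint_add := by
  intro z w
  by_cases hz : z ∈ L.lattice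
  · rw [toPoint_of_mem hz, zero_add, add_comm z w]
    exact toPoint_add_coe w ⟨z, hz⟩
  by_cases hw : w ∈ L.lattice
  · rw [toPoint_of_mem hw, add_zero]
    exact toPoint_add_coe z ⟨w, hw⟩
  by_cases hzw : z + w ∈ L.lattice
  · have : w = -z + (z + w) := by ring
    rw [toPoint_of_mem hzw, this, toPoint_add_coe (-z) ⟨z + w, hzw⟩, toPoint_neg, add_neg_cancel]
  by_cases hzw' : z - w ∈ L.lattice
  · -- tangent case
    have hwz : w = z + -(z - w) := by ring
    have h2z : 2 * z ∉ L.lattice := fun h ↦ hzw (by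
      have : z + w = 2 * z - (z - w) := by ring
      rw [this]; exact sub_mem h hzw')
    have h1 : L.toPoint w = L.toPoint z := by
      rw [hwz]; exact toPoint_add_coe z ⟨-(z - w), neg_mem hzw'⟩
    have h2 : L.toPoint (z + w) = L.toPoint (2 * z) := by
      have : z + w = 2 * z + -(z - w) := by ring
      rw [this]; exact toPoint_add_coe (2 * z) ⟨-(z - w), neg_mem hzw'⟩
    rw [h1, h2]
    exact L.toPoint_two_mul hz h2z
  · -- chord case
    have hne : ℘[L] z ≠ ℘[L] w := by
      intro h
      rcases ((L.weierstrassP_eq_weierstrassP_iff hw hz).mp h.symm).symm with h' | h'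
      · exact hzw' (by simpa using neg_mem h')
      · exact hzw (by rwa [add_comm] at h')
    exact L.toPoint_add_of_weierstrassP_ne hz hw hne

variable {L}

/-- **Silverman AEC VI.3.6(b), unconditional**: for a Weierstrass model `W/ℂ` with
`g₂(Λ) = c₄(W)/12`, `g₃(Λ) = c₆(W)/216` there is a surjective group homomorphism `u : ℂ →+ W(ℂ)`
with kernel `Λ`, given off `Λ` by `z ↦ (℘(z) − b₂/12, (℘'(z) − a₁(℘(z) − b₂/12) − a₃)/2)`
(`exists_addMonoidHom_of_g₂_g₃` of `ComplexTorus.lean` fed with `toPoint_add_holds`). This is the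
conclusion of the named fact `Literature.NumberTheory.EllipticCurves.ModularForms.IsNeronLatticeOf.exists_uniformize`
(`ModularParametrization.lean`) for `(W, L)`. [cite: SilvermanAEC2009, Prop. VI.3.6(b)] -/
theorem exists_addMonoidHom_of_g₂_g₃' {W : WeierstrassCurve ℂ} (h₂ : L.g₂ = W.c₄ / 12)
    (h₃ : L.g₃ = W.c₆ / 216) :
    ∃ u : ℂ →+ W.toAffine.Point,
      (u.ker : Set ℂ) = L.lattice ∧ Function.Surjective u ∧
        ∀ z ∉ L.lattice, ∃ hz,
          u z = .some (℘[L] z - W.b₂ / 12)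
            ((℘'[L] z - W.a₁ * (℘[L] z - W.b₂ / 12) - W.a₃) / 2) hz :=
  exists_addMonoidHom_of_g₂_g₃ L.toPoint_add_holds h₂ h₃

/-- **Silverman AEC VI.3.6(b) for `E_Λ`, unconditional**: a surjective group homomorphism
`ℂ →+ E_Λ(ℂ)` with kernel `Λ` which is `z ↦ (℘(z), ℘'(z)/2)` off `Λ`.
[cite: SilvermanAEC2009, Prop. VI.3.6(b)] -/
theorem exists_addMonoidHom_curve' :
    ∃ u : ℂ →+ L.curve.toAffine.Point,
      (u.ker : Set ℂ) = L.lattice ∧ Function.Surjective u ∧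
        ∀ z, z ∉ L.lattice → ∃ hz, u z = .some (℘[L] z) (℘'[L] z / 2) hz :=
  exists_addMonoidHom_curve L.toPoint_add_holds

end ToPointAdd

end PeriodPair

end
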